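import Summits.BirchSwinnertonDyer.BirchSwinnertonDyer.Theses.KatoDescentTamePotSupersingular
import HarnessLib

/-!
# Route `KatoDescentTamePotSupersingular` (rung K8-t′, cell `bsd-potss`): the GLUE item
# `PublishedInputsTameOfNamedInputs` (stmt-BirchSwinnertonDyer-19425) — the eight by-name alias children
# give the parent `PublishedInputsTame` by `∧`-introduction

Route rev 5 (K8-t′) split the cite-level support `PublishedInputsTame` (stmt 19198) into eight BY-NAME ALIAS
children (`PublishedInputKatoA160`, `PublishedInputRankEqAnalyticRank`, `PublishedInputEntireLFunction`,
`PublishedInputIsogenyInvarianceBSD`, `PublishedInputCasselsTatePairing`, `PublishedInputKatoA161Tamagawa`,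
`PublishedInputKatoA161FineSelmer`, `PublishedInputCMRankZeroBSD`) plus this glue, so that every cite-only
head constant in the cone of `closes` is item-stated (staffability rule). The glue is pure logic:
children 1–5 are, by definition, the five conjuncts of the parent in order; children 6–8 are unused
(aliases of the conjuncts of `KatoTamagawaExactInputs` / `PublishedInputsFineSelmerCM`). Nothing
mathematical is claimed: the children remain open cite-level inputs (published theorems carried BY NAME),
and BSD is not advanced by this file. Seat `bsd-potss-k9-c2` (prover-bsd-potss-k9-c2-g3-0), generation 3;
proof term = the planner's certified sketch `fun h₁ h₂ h₃ h₄ h₅ _ _ _ => ⟨h₁, h₂, h₃, h₄, h₅⟩`.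
-/

set_option autoImplicit false
-- sibling precedent (`KatoDescentPotSupersingularAssembly.lean`): the directory name repeats the summit name
set_option linter.dupNamespace false

namespace Summit.BirchSwinnertonDyer.BirchSwinnertonDyer.Theorems

/-- **GLUE `PublishedInputsTameOfNamedInputs` (item stmt-BirchSwinnertonDyer-19425)**: the five by-name
alias children `PublishedInputKatoA160`, `PublishedInputRankEqAnalyticRank`,
`PublishedInputEntireLFunction`, `PublishedInputIsogenyInvarianceBSD`, `PublishedInputCasselsTatePairing`
are definitionally the five conjuncts of `PublishedInputsTame`, so `∧`-introduction gives the parent; the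
last three children are not used. Pure logic; the children themselves stay open cite-level inputs.
[cite: Kato2004Asterisque, Thm. 14.5 (3)] [cite: Miller2011LMS, Def. 1.1] -/
theorem publishedInputsTameOfNamedInputs_proof :
    Summit.BirchSwinnertonDyer.BirchSwinnertonDyer.Theses.KatoDescentTamePotSupersingular.PublishedInputsTameOfNamedInputs :=
  fun h₁ h₂ h₃ h₄ h₅ _ _ _ => ⟨h₁, h₂, h₃, h₄, h₅⟩

end Summit.BirchSwinnertonDyer.BirchSwinnertonDyer.Theorems
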